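import Summits.ABC.StewartYu.PadicG3TwoBasisStepSat
import Summits.ABC.StewartYu.PadicG3TwoSiegelSat
import Mathlib.LinearAlgebra.Matrix.ToLinearEquiv
import HarnessLib

/-!
# Cell abc-stewartyu, WP-L.P(2) (crux r4 `PadicCoreTwoRat`, stmt-ABC-20504), START layer: LEVEL `0` of the 𝔑-THREADED frame
# — Siegel's lemma on the pre-scaled Fel'dman basis × a sub-box family carrying a VIRTUAL box, and the C-IMAGE family of the
# crux's α-box

`Summits/ABC/StewartYu/PadicG3TwoLevelZeroSat.lean` — cell `abc-stewartyu` (HOME `run/shared/lean/pub/abc-stewartyu/`), route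
`YuMatveevShapeRat`, seat p3 (g9, WP-L.P(2) lead; design memo HOME/p3/memo-11 §2 rows «Siegel / START», «𝔑 set-up»).  One
`Finset`-valued definition (`famBoxC`) and theorems; no named fact.

* **`siegelTwo_feldSat`** — `SiegelTwo σ (ShSat F Bv (ShFeldSat σ F Bv₀ I* H L₀))` for ANY pre-family `B ⊆ famBox L₀ (Dbox 0) (Dθ 0)`
  whose members have virtual exponents in `Bv₀` (`|(κ ᵥ* U)ⱼ| ≤ Bv₀ⱼ`, `Bv₀ ≤ Bv 0`): the landed level-`0` assembly
  `siegelTwo_feldRs_of_card` (p5) with Siegel's lemma taken on the virtual clearing denominator (`siegelTwo_of_slab_siegel_sat`)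
  and the shape `ShFeldSat` at base point `0`;
* `famBoxC L₀ side C` — the C-IMAGE FAMILY: Fel'dman degrees `ℓ ≤ L₀` × the image of the crux's α-box `|λⱼ| ≤ sideⱼ` under
  `λ ↦ λ ᵥ* C` (the ϑ-coordinates of `αo^λ`); `mem_famBoxC`, **`card_famBoxC`** (`= (L₀+1)·∏(2 sideⱼ+1)` when `det C ≠ 0` — the
  landed count, Nesterenko's `N·∏` refinement is not needed), `famBoxC_subset_famBox` (coordinate box `Σⱼ sideⱼ|C j k| ≤ Dco k`),
  **`vbox_famBoxC`** (`(λ ᵥ* C) ᵥ* U = N·λ` when `C·U = N·1`, so the virtual box is `N·side`).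

WHAT THIS IS NOT: no numbers, no schedule; no crux moves (A1.L not moved).

References: K. Yu, Acta Math. 211 (2013), Lemma 4.2 and (5.22); Yu. V. Nesterenko, LNM 1819 (2003), §3.3–3.5 (Siegel step on
`𝔏 ⊂ 𝔑`, (3.12)); HOME/p3/memo-11 §2.
-/

noncomputable section

open Finset Polynomial
open scoped Matrix
open Literature.NumberTheory.Transcendental
open Literature.NumberTheory.Transcendental (FeldmanDelta.den)
open Literature.NumberTheory.Transcendental.FeldmanDelta
open Literature.NumberTheory.Transcendental.CW77.Setup (Tau tauNorm)

namespace Summit.ABC.StewartYu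

namespace TwoSetup

open Summit.ABC.StewartYu.FeldmanBasis Summit.ABC.StewartYu.G3Boxes

variable {S : TwoSetup} (σ : S.G3TwoSched) (F : S.SatData) (Bv : ℕ → Fin (S.d + 1) → ℕ)
  (Bv₀ : Fin (S.d + 1) → ℕ)

/-! ### Level `0` on a sub-box family with a virtual box -/

/-- **LEVEL `0` OF THE 𝔑-THREADED FRAME**: for a pre-family `B ⊆ famBox L₀ (Dbox 0) (Dθ 0)` of pre-scaled Fel'dman unknowns
`(ℓ, κ)` whose exponent vectors have virtual exponents in `Bv₀ ≤ Bv 0`, Siegel's lemma on the slab class (virtual clearing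
denominator `F.Dm (Bv 0)`) gives `SiegelTwo σ (ShSat F Bv (ShFeldSat σ F Bv₀ I* H L₀))` (base point `0`).
[cite: Yu2013, Lemma 4.2 and (5.22)] [cite: Nesterenko2003, §3.5 Prop 3.9; shape only] -/
theorem siegelTwo_feldSat (H L₀ : ℕ) (hH : 1 ≤ H)
    (B : Finset (ℕ × ((Fin S.d → ℤ) × ℤ))) (hB : B ⊆ famBox L₀ (σ.Dbox 0) (σ.Dθ 0))
    (hvB : ∀ i ∈ B, ∀ j, |((Fin.snoc i.2.1 i.2.2 : Fin (S.d + 1) → ℤ) ᵥ* F.U) j| ≤ (Bv₀ j : ℤ))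
    (hBv0 : ∀ j, Bv₀ j ≤ Bv 0 j)
    (hΛ : ‖S.Λ₀‖ ≤ ((2 : ℝ) ^ (σ.m + 3))⁻¹)
    (hT0 : 1 ≤ σ.T0 0)
    (hE : 2 * 2 ^ σ.m * (eqSet S.d (σ.N0 0) (σ.T0 0)).card ≤ B.card)
    (hcardB : B.card ≤ σ.cardB 0)
    (hL : L₀ ≤ σ.D₀)
    (hXb : ∀ i ∈ B, ∀ j, |S.dirScalar i.2.1 i.2.2 j| ≤ σ.Xb 0)
    (hBw : ∀ ℓ, ℓ ≤ L₀ → ‖((den ℓ H : ℚ_[2]))⁻¹‖ * (4 * (2 : ℝ) ^ σ.m) ^ ℓ ≤ σ.Bw 0)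
    (hden₀ : ∀ (x : ℤ) (τ : Tau S.d), σ.den₀ 0 x τ = Nat.lcmUpto H ^ τ.1)
    (hM₀ : ∀ (x : ℤ) (τ : Tau S.d), ∀ ℓ, ℓ ≤ L₀ →
      (3 : ℝ) ^ (σ.Istar * τ.1) * ((Nat.lcmUpto H : ℝ) ^ τ.1 *
        (Real.exp (H / Real.exp 1) * (Real.exp 1 * (1 + (3 : ℝ) ^ σ.Istar * |(x : ℝ)| / H)) ^ ℓ)) ≤
        σ.M₀ 0 x τ)
    {M₀E : ℤ} (hM₀E : ∀ e ∈ eqSet S.d (σ.N0 0) (σ.T0 0), σ.M₀ 0 e.1 e.2 ≤ M₀E)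
    {Amax : ℝ} (hAmax : 1 ≤ Amax)
    (hA : ∀ e ∈ eqSet S.d (σ.N0 0) (σ.T0 0),
      (M₀E : ℝ) * (σ.Xb 0 : ℝ) ^ (∑ j, e.2.2 j) * ((F.Dm (Bv 0) e.1 : ℝ)) ^ 2 ≤ Amax)
    (hP : ⌈(B.card : ℝ) * Amax⌉ ≤ σ.P) :
    SiegelTwo σ (ShSat F Bv (ShFeldSat σ F Bv₀ σ.Istar H L₀)) := by
  classical
  -- as the landed `siegelTwo_feldRs_of_card` (p5), with Siegel on the virtual clearing denominator
  set E : Finset (ℤ × Tau S.d) := eqSet S.d (σ.N0 0) (σ.T0 0) with hEdef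
  set R : ℕ × ((Fin S.d → ℤ) × ℤ) → ℚ[X] := fun i => feldRs i.1 H σ.Istar with hRdef
  set u : ℕ × ((Fin S.d → ℤ) × ℤ) → Fin S.d → ℤ := fun i => i.2.1 with hudef
  set uθ : ℕ × ((Fin S.d → ℤ) × ℤ) → ℤ := fun i => i.2.2 with huθdef
  have hbox := S.feldman_box_le B hB
  have hlcm1 : 1 ≤ Nat.lcmUpto H := Nat.lcmUpto_pos H
  have hden₀1 : ∀ e ∈ E, 1 ≤ σ.den₀ 0 e.1 e.2 := by
    intro e _; rw [hden₀]; exact Nat.one_le_pow _ _ hlcm1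
  have hhasse : ∀ i ∈ B, ∀ (x : ℤ) (τ : Tau S.d), ∃ z₀ : ℤ,
      (σ.den₀ 0 x τ : ℚ) * (hasseDeriv τ.1 (R i)).eval (x : ℚ) = z₀ ∧ |z₀| ≤ σ.M₀ 0 x τ := by
    intro i hi x τ
    rw [hden₀]
    have h := exists_int_lcm_pow_mul_hasse_feldRs i.1 hH σ.Istar τ.1 x (hM₀ x τ i.1 (mem_famBox.mp (hB hi)).1)
    simpa only [hRdef] using h
  have hR : ∀ e ∈ E, ∀ i ∈ B, ∃ z₀ : ℤ,
      ((σ.den₀ 0 e.1 e.2 : ℕ) : ℚ) * (hasseDeriv e.2.1 (R i)).eval (e.1 : ℚ) = z₀ ∧ |z₀| ≤ M₀E := by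
    intro e he i hi
    obtain ⟨z₀, hz₀, hle⟩ := hhasse i hi e.1 e.2
    exact ⟨z₀, hz₀, hle.trans (hM₀E e he)⟩
  -- the virtual box of the pre-family (`allκ` form) and the monomial datum
  have hvbox : ∀ i ∈ B, ∀ j, |(S.allκ u uθ i ᵥ* F.U) j| ≤ (Bv 0 j : ℤ) := by
    intro i hi j
    exact (hvB i hi j).trans (by exact_mod_cast hBv0 j)
  have hm := F.monomialDatum_of_vbox u uθ hvbox
  obtain ⟨𝔏, p, h𝔏B, _hcnt, _h𝔏ne, hslab, hsupp, ⟨i₀, hpi₀⟩, hpbd, hsol⟩ :=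
    S.exists_g3_slab_siegel_gen R u uθ B σ.m hΛ E (eqSet_nonempty S.d (σ.N0 0) hT0) hE
      (fun e => σ.den₀ 0 e.1 e.2) hden₀1 hR hXb (F.Dm (Bv 0)) (F.one_le_Dm (Bv 0))
      (fun x => ((F.Dm (Bv 0) x : ℤ)) ^ 2) hm hAmax
      (fun e he => by have := hA e he; push_cast at this ⊢; exact this)
  have hi₀ : i₀ ∈ 𝔏 := hsupp i₀ hpi₀
  have h𝔏card : 𝔏.card ≤ B.card := card_le_card h𝔏B
  have hdegs := S.feldRs_degrees H σ.Istar hL 𝔏 (h𝔏B.trans hB)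
  have hρ1 : (1 : ℝ) ≤ 4 * (2 : ℝ) ^ σ.m := by
    have : (1 : ℝ) ≤ 2 ^ σ.m := one_le_pow₀ (by norm_num)
    nlinarith
  -- the shape `ShFeldSat` at level `0`, base point `0`
  have hzeroU : ∀ j, |((Fin.snoc (fun _ : Fin S.d => (0 : ℤ)) (0 : ℤ) : Fin (S.d + 1) → ℤ) ᵥ* F.U) j| ≤ (Bv₀ j : ℤ) := by
    intro j
    have hz : (Fin.snoc (fun _ : Fin S.d => (0 : ℤ)) (0 : ℤ) : Fin (S.d + 1) → ℤ) = 0 := by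
      funext k; refine Fin.lastCases ?_ (fun l => ?_) k
      · simp only [Fin.snoc_last, Pi.zero_apply]
      · simp only [Fin.snoc_castSucc, Pi.zero_apply]
    rw [hz, Matrix.zero_vecMul, Pi.zero_apply, abs_zero]; exact_mod_cast Nat.zero_le _
  have hshape : ShFeldSat σ F Bv₀ σ.Istar H L₀ 0 ⟨𝔏, R, u, uθ, p, i₀⟩ := by
    refine ⟨⟨fun i hi => ?_, fun _ => 0, 0, fun _ => by simp, by simp, fun i _ => ⟨fun j => ?_, ?_⟩⟩,
      fun i hi => hvB i (h𝔏B hi), fun _ => 0, 0, hzeroU, fun i _ => ⟨fun j => ?_, ?_⟩⟩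
    · have hmem := mem_famBox.mp (hB (h𝔏B hi))
      exact ⟨hmem.1, by rw [Nat.sub_zero], hmem.2.1, hmem.2.2⟩
    all_goals simp [hudef, huθdef]
  refine ⟨⟨𝔏, R, u, uθ, p, i₀⟩, ?_, ?_⟩
  · exact
      { card_le := h𝔏card.trans hcardB
        exists_ne := ⟨i₀, hi₀, hpi₀⟩
        deg_ne := hdegs.1
        R_ne := hdegs.2.1
        deg_le := hdegs.2.2
        p_le := by
          intro i _
          refine (hpbd i).trans (le_trans ?_ hP)
          exact Int.ceil_le_ceil (mul_le_mul_of_nonneg_right (by exact_mod_cast h𝔏card)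
            (le_trans zero_le_one hAmax))
        u_le := (S.feldman_box_le 𝔏 (h𝔏B.trans hB)).1
        uθ_le := (S.feldman_box_le 𝔏 (h𝔏B.trans hB)).2
        dir_le := fun i hi j => hXb i (h𝔏B hi) j
        slab := hslab i₀ hi₀
        wt := fun i hi t₀ k =>
          (norm_coeff_hw_feldRs_mul_pow_le (fun i : ℕ × ((Fin S.d → ℤ) × ℤ) => i.1) H σ.Istar i t₀ k
            hρ1).trans (hBw i.1 (mem_famBox.mp (hB (h𝔏B hi))).1)
        hasse := fun i hi x τ => hhasse i (h𝔏B hi) x τ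
        shape := ⟨fun i hi => hvbox i (h𝔏B hi), hshape⟩ }
  · rw [G3Fam.vanish_all_iff]
    exact vanish_of_eqSet S R u uθ 𝔏 p hsol

/-! ### The C-image family of the crux's α-box -/

/-- **The C-image family**: Fel'dman degrees `ℓ ≤ L₀` × the ϑ-coordinates `λ ᵥ* C` of the points `λ` of the α-box `|λⱼ| ≤ sideⱼ`.
[cite: Nesterenko2003, §3.3 (3.12); shape only] -/
def famBoxC (L₀ : ℕ) (side : Fin (S.d + 1) → ℕ) (C : Matrix (Fin (S.d + 1)) (Fin (S.d + 1)) ℤ) :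
    Finset (ℕ × ((Fin S.d → ℤ) × ℤ)) :=
  (range (L₀ + 1)) ×ˢ ((Fintype.piFinset fun j => Icc (-(side j : ℤ)) (side j)).image
    fun lam => (fun j : Fin S.d => (lam ᵥ* C) (Fin.castSucc j), (lam ᵥ* C) (Fin.last S.d)))

/-- Membership in the C-image family. [folklore] -/
theorem mem_famBoxC {L₀ : ℕ} {side : Fin (S.d + 1) → ℕ} {C : Matrix (Fin (S.d + 1)) (Fin (S.d + 1)) ℤ}
    {i : ℕ × ((Fin S.d → ℤ) × ℤ)} :
    i ∈ famBoxC (S := S) L₀ side C ↔ i.1 ≤ L₀ ∧ ∃ lam : Fin (S.d + 1) → ℤ, (∀ j, |lam j| ≤ (side j : ℤ)) ∧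
      (Fin.snoc i.2.1 i.2.2 : Fin (S.d + 1) → ℤ) = lam ᵥ* C := by
  unfold famBoxC
  rw [mem_product, mem_range, Nat.lt_succ_iff, mem_image]
  constructor
  · rintro ⟨h1, lam, hlam, heq⟩
    refine ⟨h1, lam, fun j => ?_, ?_⟩
    · have := (Fintype.mem_piFinset.mp hlam) j
      rw [mem_Icc] at this; exact abs_le.mpr this
    · funext k
      refine Fin.lastCases ?_ (fun j => ?_) k
      · simp only [Fin.snoc_last, ← heq]
      · simp only [Fin.snoc_castSucc, ← heq]
  · rintro ⟨h1, lam, hlam, heq⟩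
    refine ⟨h1, lam, Fintype.mem_piFinset.mpr fun j => mem_Icc.mpr (abs_le.mp (hlam j)), ?_⟩
    have h2 : i.2 = (i.2.1, i.2.2) := rfl
    rw [h2]
    congr 1
    · funext j; have := congrFun heq (Fin.castSucc j); simpa only [Fin.snoc_castSucc] using this.symm
    · have := congrFun heq (Fin.last S.d); simpa only [Fin.snoc_last] using this.symm

/-- **The C-image family has the landed count** `(L₀+1)·∏ⱼ(2 sideⱼ + 1)` (`λ ↦ λ ᵥ* C` is injective for `det C ≠ 0`).
[cite: Nesterenko2003, §3.3; shape only] -/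
theorem card_famBoxC (L₀ : ℕ) (side : Fin (S.d + 1) → ℕ) (C : Matrix (Fin (S.d + 1)) (Fin (S.d + 1)) ℤ)
    (hC : C.det ≠ 0) :
    (famBoxC (S := S) L₀ side C).card = (L₀ + 1) * ∏ j, (2 * side j + 1) := by
  classical
  unfold famBoxC
  rw [card_product, card_range, card_image_of_injOn, Fintype.card_piFinset]
  · congr 1
    refine Finset.prod_congr rfl fun j _ => ?_
    rw [Int.card_Icc]; omega
  · intro v _ w _ h
    have h1 : v ᵥ* C = w ᵥ* C := by
      funext k
      refine Fin.lastCases ?_ (fun j => ?_) k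
      · exact congrArg (fun q : (Fin S.d → ℤ) × ℤ => q.2) h
      · exact congrFun (congrArg (fun q : (Fin S.d → ℤ) × ℤ => q.1) h) j
    have h0 : (v - w) ᵥ* C = 0 := by rw [Matrix.sub_vecMul]; exact sub_eq_zero.mpr h1
    by_contra hne
    exact hC (Matrix.exists_vecMul_eq_zero_iff.mp ⟨v - w, sub_ne_zero.mpr hne, h0⟩)

/-- **The coordinate box of the C-image family**: if `Σⱼ sideⱼ·|C j k| ≤ Dcoₖ` then every member lies in
`famBox L₀ (Dco ∘ castSucc) (Dco last)`. [folklore] -/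
theorem famBoxC_subset_famBox {L₀ : ℕ} {side : Fin (S.d + 1) → ℕ} {C : Matrix (Fin (S.d + 1)) (Fin (S.d + 1)) ℤ}
    {Dco : Fin (S.d + 1) → ℕ} (hDco : ∀ k, ∑ j, (side j : ℤ) * |C j k| ≤ (Dco k : ℤ)) :
    famBoxC (S := S) L₀ side C ⊆ famBox L₀ (fun j => Dco (Fin.castSucc j)) (Dco (Fin.last S.d)) := by
  intro i hi
  obtain ⟨h1, lam, hlam, heq⟩ := mem_famBoxC.mp hi
  have hk : ∀ k, |(Fin.snoc i.2.1 i.2.2 : Fin (S.d + 1) → ℤ) k| ≤ (Dco k : ℤ) := by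
    intro k
    rw [heq]
    simp only [Matrix.vecMul, dotProduct]
    calc |∑ j, lam j * C j k| ≤ ∑ j, |lam j * C j k| := abs_sum_le_sum_abs _ _
      _ ≤ ∑ j, (side j : ℤ) * |C j k| := by
          refine sum_le_sum fun j _ => ?_
          rw [abs_mul]; exact mul_le_mul_of_nonneg_right (hlam j) (abs_nonneg _)
      _ ≤ Dco k := hDco k
  refine mem_famBox.mpr ⟨h1, fun j => ?_, ?_⟩
  · have := hk (Fin.castSucc j); simpa only [Fin.snoc_castSucc] using this
  · have := hk (Fin.last S.d); simpa only [Fin.snoc_last] using this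

/-- **The virtual box of the C-image family**: if `C·U = N·1` then `(λ ᵥ* C) ᵥ* U = N·λ`, so every member has
`|(κ ᵥ* U)ⱼ| ≤ N·sideⱼ`. [cite: Nesterenko2003, §3.5 (N𝔑 ⊆ ℤⁿ); shape only] -/
theorem vbox_famBoxC {L₀ : ℕ} {side : Fin (S.d + 1) → ℕ} {C U : Matrix (Fin (S.d + 1)) (Fin (S.d + 1)) ℤ} {N : ℕ}
    (hCU : C * U = (N : ℤ) • (1 : Matrix (Fin (S.d + 1)) (Fin (S.d + 1)) ℤ)) :
    ∀ i ∈ famBoxC (S := S) L₀ side C, ∀ j, |((Fin.snoc i.2.1 i.2.2 : Fin (S.d + 1) → ℤ) ᵥ* U) j| ≤ ((N * side j : ℕ) : ℤ) := by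
  intro i hi j
  obtain ⟨_, lam, hlam, heq⟩ := mem_famBoxC.mp hi
  rw [heq, Matrix.vecMul_vecMul, hCU, Matrix.vecMul_smul, Matrix.vecMul_one]
  simp only [Pi.smul_apply, smul_eq_mul, abs_mul]
  push_cast
  rw [abs_of_nonneg (by positivity : (0 : ℤ) ≤ N)]
  exact mul_le_mul_of_nonneg_left (hlam j) (by positivity)

end TwoSetup

end Summit.ABC.StewartYu

end
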